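import Mathlib.MeasureTheory.Integral.Bochner.Basic
import Mathlib.MeasureTheory.Constructions.BorelSpace.Basic
import Literature.MathematicalPhysics.QuantumLattice.LatticeGaugeDLR
import Literature.Probability.Process.ItoIntegralConstruction
import HarnessLib

/-!
# Weak convergence upgrades to `∫ g ℓ` under uniform second moments

Crux `stmt-QuantumFields-8760`
(`Summit.QuantumFields.YangMills.Theses.EquipartitionCriticality.EquipartitionPinsProbe`), line
`Sketch`, stub `stub_uiLimit` (TS6).

Setting: probability measures `ν_k`, `τ` on the `ℝ^D`-valued `2`-cochains
`Ω := ZdPlaquette 4 → Fin D → ℝ` of `ℤ⁴` (product topology, product σ-algebra; `Ω` is a countable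
product of copies of `ℝ`, so continuous functions are measurable, `Pi.opensMeasurableSpace`) with
`ν_k → τ` weakly, i.e. `∫ f dν_k → ∫ f dτ` for every bounded continuous `f : Ω → ℝ`. If `g` is
bounded continuous, `ℓ` is continuous and `∫ ℓ² dν_k`, `∫ ℓ² dτ` are bounded by a common `C`, then
`∫ g ℓ dν_k → ∫ g ℓ dτ` (uniform integrability).

Proof (`TangentUiLimit.tendsto_integral_mul_of_weakLimit`, on any measurable space carrying a
topology whose open sets are measurable, finite measures): truncate `ℓ` by the clamp
`φ_M x := max (-M) (min M x)` (`Literature.Probability.Process.clamp`; elementary facts: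
`|φ_M x| ≤ |M|` and `|x - φ_M x| ≤ x² / M` for `M > 0`). Then `g · (φ_M ∘ ℓ)` is bounded
continuous, so its integrals converge by weak convergence, while each tail satisfies
`|∫ g ℓ dμ - ∫ g (φ_M ∘ ℓ) dμ| ≤ (K / M) ∫ ℓ² dμ ≤ K C / M` (`|g| ≤ K`). Given `ε > 0` choose `M`
with `K C / M = ε / 4`, then `k` large. Mathlib plus the tree's `clamp` lemmas
(`Literature.Probability.Process.ItoIntegralConstruction`).
-/

noncomputable section

open MeasureTheory Filter Topology
open Literature.MathematicalPhysics.QuantumLattice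
open Literature.Probability.Process (clamp abs_clamp_le continuous_clamp)

namespace Summit.QuantumFields.YangMills.Theorems.EquipartitionPinsProbe

namespace TangentUiLimit

/-- The truncation error: `|x - clamp M x| ≤ x² / M` for `M > 0` (it vanishes for `|x| ≤ M` and
is at most `|x| ≤ x² / M` otherwise). -/
theorem abs_sub_clamp_le {M : ℝ} (hM : 0 < M) (x : ℝ) : |x - clamp M x| ≤ x ^ 2 / M := by
  unfold clamp
  rw [le_div_iff₀ hM]
  rcases le_total M x with h | h
  · rw [min_eq_left h, max_eq_right (by linarith : -M ≤ M), abs_of_nonneg (by linarith)]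
    nlinarith [mul_nonneg (by linarith : (0 : ℝ) ≤ x) (sub_nonneg.2 h)]
  · rw [min_eq_right h]
    rcases le_total (-M) x with h' | h'
    · rw [max_eq_right h', sub_self, abs_zero, zero_mul]
      positivity
    · rw [max_eq_left h', abs_of_nonpos (by linarith)]
      nlinarith [mul_nonneg_of_nonpos_of_nonpos (by linarith : x ≤ 0) (by linarith : x + M ≤ 0)]

/-- **Tail bound for the truncation.** For a finite measure `μ`, `g`, `ℓ` a.e. strongly
measurable with `|g| ≤ K` and `ℓ²` integrable, and `M > 0`: `g ℓ` and `g · clamp M ∘ ℓ` are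
integrable and `|∫ g ℓ dμ - ∫ g (clamp M ∘ ℓ) dμ| ≤ (K / M) ∫ ℓ² dμ`. -/
theorem abs_integral_mul_sub_clamp_le {Ω : Type*} [MeasurableSpace Ω] {μ : Measure Ω}
    [IsFiniteMeasure μ] {g ℓ : Ω → ℝ} (hgm : AEStronglyMeasurable g μ)
    (hℓm : AEStronglyMeasurable ℓ μ) {K : ℝ} (hgK : ∀ Y, |g Y| ≤ K)
    (hℓ2 : Integrable (fun Y => ℓ Y ^ 2) μ) {M : ℝ} (hM : 0 < M) :
    Integrable (fun Y => g Y * ℓ Y) μ ∧ Integrable (fun Y => g Y * clamp M (ℓ Y)) μ ∧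
      |∫ Y, g Y * ℓ Y ∂μ - ∫ Y, g Y * clamp M (ℓ Y) ∂μ| ≤ K / M * ∫ Y, ℓ Y ^ 2 ∂μ := by
  have hcm : AEStronglyMeasurable (fun Y => clamp M (ℓ Y)) μ :=
    (continuous_clamp M).comp_aestronglyMeasurable hℓm
  -- the truncated product is bounded by `K * M`
  have h1 : Integrable (fun Y => g Y * clamp M (ℓ Y)) μ :=
    Integrable.of_bound (hgm.mul hcm) (K * M) (ae_of_all _ fun Y => by
      rw [Real.norm_eq_abs, abs_mul]
      exact mul_le_mul (hgK Y) ((abs_clamp_le M _).trans (abs_of_pos hM).le) (abs_nonneg _)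
        ((abs_nonneg _).trans (hgK Y)))
  -- the tail is dominated by `K / M * ℓ²`
  have hdom : ∀ Y, |g Y * (ℓ Y - clamp M (ℓ Y))| ≤ K / M * ℓ Y ^ 2 := fun Y => by
    rw [abs_mul, div_mul_eq_mul_div, mul_div_assoc]
    exact mul_le_mul (hgK Y) (abs_sub_clamp_le hM _) (abs_nonneg _)
      ((abs_nonneg _).trans (hgK Y))
  have h2 : Integrable (fun Y => g Y * (ℓ Y - clamp M (ℓ Y))) μ :=
    Integrable.mono' (hℓ2.const_mul (K / M)) (hgm.mul (hℓm.sub hcm))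
      (ae_of_all _ fun Y => by rw [Real.norm_eq_abs]; exact hdom Y)
  have h0 : Integrable (fun Y => g Y * ℓ Y) μ := by
    have he : (fun Y => g Y * ℓ Y) = fun Y => g Y * clamp M (ℓ Y) + g Y * (ℓ Y - clamp M (ℓ Y)) :=
      funext fun Y => by ring
    rw [he]
    exact h1.add h2
  refine ⟨h0, h1, ?_⟩
  rw [← integral_sub h0 h1]
  have he : (fun Y => g Y * ℓ Y - g Y * clamp M (ℓ Y)) = fun Y => g Y * (ℓ Y - clamp M (ℓ Y)) :=
    funext fun Y => by ring
  rw [he, ← integral_const_mul]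
  exact (abs_integral_le_integral_abs).trans
    (integral_mono h2.abs (hℓ2.const_mul (K / M)) fun Y => hdom Y)

/-- **Weak convergence plus uniformly bounded second moments gives convergence of `∫ g ℓ`.**
On a measurable space carrying a topology with measurable open sets, let finite measures `ν k`
converge to the finite measure `τ` against bounded continuous functions, let `g` be bounded
continuous and `ℓ` continuous with `∫ ℓ² dν_k ≤ C` for all `k` and `∫ ℓ² dτ ≤ C`. Then
`∫ g ℓ dν_k → ∫ g ℓ dτ`: truncate `ℓ` at level `M` (`clamp M`), use weak convergence for the
bounded continuous `g · clamp M ∘ ℓ` and the tail bound `abs_integral_mul_sub_clamp_le`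
(`≤ K C / M` on both sides), and let `M → ∞`. -/
theorem tendsto_integral_mul_of_weakLimit {Ω : Type*} [MeasurableSpace Ω] [TopologicalSpace Ω]
    [OpensMeasurableSpace Ω] {ν : ℕ → Measure Ω} {τ : Measure Ω}
    [∀ k, IsFiniteMeasure (ν k)] [IsFiniteMeasure τ]
    (hweak : ∀ f : Ω → ℝ, Continuous f → (∃ C : ℝ, ∀ Y, |f Y| ≤ C) →
      Tendsto (fun k : ℕ => ∫ Y, f Y ∂(ν k)) atTop (𝓝 (∫ Y, f Y ∂τ)))
    {g ℓ : Ω → ℝ} (hg : Continuous g) (hgb : ∃ C : ℝ, ∀ Y, |g Y| ≤ C) (hℓ : Continuous ℓ)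
    (hL2 : ∃ C : ℝ, (∀ k, Integrable (fun Y => (ℓ Y) ^ 2) (ν k) ∧ ∫ Y, (ℓ Y) ^ 2 ∂(ν k) ≤ C) ∧
      Integrable (fun Y => (ℓ Y) ^ 2) τ ∧ ∫ Y, (ℓ Y) ^ 2 ∂τ ≤ C) :
    Tendsto (fun k : ℕ => ∫ Y, g Y * ℓ Y ∂(ν k)) atTop (𝓝 (∫ Y, g Y * ℓ Y ∂τ)) := by
  obtain ⟨Cg, hCg⟩ := hgb
  obtain ⟨C, hν, hτi, hτC⟩ := hL2
  -- positive versions of the constants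
  set K : ℝ := max Cg 1
  have hK : 0 < K := lt_max_of_lt_right one_pos
  have hgK : ∀ Y, |g Y| ≤ K := fun Y => (hCg Y).trans (le_max_left _ _)
  set C' : ℝ := max C 1
  have hC' : 0 < C' := lt_max_of_lt_right one_pos
  rw [Metric.tendsto_atTop]
  intro ε hε
  -- truncation level
  set M : ℝ := 4 * K * C' / ε
  have hM : 0 < M := by positivity
  have hKM : K / M * C' = ε / 4 := by
    simp only [M]
    field_simp
  -- weak convergence for the truncated integrand
  have hfc : Continuous fun Y => g Y * clamp M (ℓ Y) := hg.mul ((continuous_clamp M).comp hℓ)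
  have hfb : ∃ C : ℝ, ∀ Y, |g Y * clamp M (ℓ Y)| ≤ C :=
    ⟨K * |M|, fun Y => by
      rw [abs_mul]
      exact mul_le_mul (hgK Y) (abs_clamp_le M _) (abs_nonneg _) hK.le⟩
  obtain ⟨N, hN⟩ := Metric.tendsto_atTop.1 (hweak _ hfc hfb) (ε / 2) (half_pos hε)
  refine ⟨N, fun k hk => ?_⟩
  have h1 := (abs_integral_mul_sub_clamp_le (μ := ν k) hg.aestronglyMeasurable
    hℓ.aestronglyMeasurable hgK (hν k).1 hM).2.2
  have h2 := (abs_integral_mul_sub_clamp_le (μ := τ) hg.aestronglyMeasurable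
    hℓ.aestronglyMeasurable hgK hτi hM).2.2
  have h1' : K / M * ∫ Y, ℓ Y ^ 2 ∂(ν k) ≤ ε / 4 :=
    hKM ▸ mul_le_mul_of_nonneg_left ((hν k).2.trans (le_max_left _ _)) (by positivity)
  have h2' : K / M * ∫ Y, ℓ Y ^ 2 ∂τ ≤ ε / 4 :=
    hKM ▸ mul_le_mul_of_nonneg_left (hτC.trans (le_max_left _ _)) (by positivity)
  have h3 := hN k hk
  rw [Real.dist_eq] at h3 ⊢
  have h4 := abs_sub_le (∫ Y, g Y * ℓ Y ∂(ν k)) (∫ Y, g Y * clamp M (ℓ Y) ∂(ν k))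
    (∫ Y, g Y * ℓ Y ∂τ)
  have h5 := abs_sub_le (∫ Y, g Y * clamp M (ℓ Y) ∂(ν k)) (∫ Y, g Y * clamp M (ℓ Y) ∂τ)
    (∫ Y, g Y * ℓ Y ∂τ)
  rw [abs_sub_comm] at h2
  linarith

end TangentUiLimit

/-- STUB `stub_uiLimit` (TS6) — **weak convergence plus uniform second moments**: if probability
measures `ν_k` on the `ℝ^D`-valued `2`-cochains of `ℤ⁴` converge weakly (against bounded
continuous functions) to `τ`, `g` is bounded continuous and `ℓ` is continuous with
`∫ ℓ² dν_k ≤ C` and `∫ ℓ² dτ ≤ C`, then `∫ g ℓ dν_k → ∫ g ℓ dτ` (truncate `ℓ`, uniform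
integrability from the `L²` bound; `TangentUiLimit.tendsto_integral_mul_of_weakLimit`; continuous
functions on the countable product `Ω` are measurable, `Pi.opensMeasurableSpace`). -/
theorem stub_uiLimit :
    ∀ (D : ℕ) (ν : ℕ → MeasureTheory.Measure (Literature.MathematicalPhysics.QuantumLattice.ZdPlaquette 4 → Fin D → ℝ))
      (τ : MeasureTheory.Measure (Literature.MathematicalPhysics.QuantumLattice.ZdPlaquette 4 → Fin D → ℝ)),
      (∀ k, MeasureTheory.IsProbabilityMeasure (ν k)) → MeasureTheory.IsProbabilityMeasure τ →
      (∀ f : (Literature.MathematicalPhysics.QuantumLattice.ZdPlaquette 4 → Fin D → ℝ) → ℝ, Continuous f → (∃ C : ℝ, ∀ Y, |f Y| ≤ C) →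
          Filter.Tendsto (fun k : ℕ => ∫ Y, f Y ∂(ν k)) Filter.atTop (nhds (∫ Y, f Y ∂τ))) →
      ∀ (g ℓ : (Literature.MathematicalPhysics.QuantumLattice.ZdPlaquette 4 → Fin D → ℝ) → ℝ), Continuous g → (∃ C : ℝ, ∀ Y, |g Y| ≤ C) →
        Continuous ℓ →
        (∃ C : ℝ, (∀ k, MeasureTheory.Integrable (fun Y => (ℓ Y) ^ 2) (ν k) ∧ ∫ Y, (ℓ Y) ^ 2 ∂(ν k) ≤ C) ∧
          MeasureTheory.Integrable (fun Y => (ℓ Y) ^ 2) τ ∧ ∫ Y, (ℓ Y) ^ 2 ∂τ ≤ C) →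
        Filter.Tendsto (fun k : ℕ => ∫ Y, g Y * ℓ Y ∂(ν k)) Filter.atTop (nhds (∫ Y, g Y * ℓ Y ∂τ)) := by
  intro D ν τ hν hτ hweak g ℓ hg hgb hℓ hL2
  haveI : ∀ k, IsProbabilityMeasure (ν k) := hν
  haveI : IsProbabilityMeasure τ := hτ
  exact TangentUiLimit.tendsto_integral_mul_of_weakLimit hweak hg hgb hℓ hL2

end Summit.QuantumFields.YangMills.Theorems.EquipartitionPinsProbe

end
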